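import Mathlib
import Literature.Analysis.FluidPDE.VectorCalculus
import Literature.Analysis.FluidPDE.VorticityCalculus
import Literature.Analysis.FluidPDE.CurlFreeLiouville
import Summits.NavierStokesRegularity.NavierStokesRegularity.Theorems.AffineBernoulliAlignedStratumTrivialZeros
import Summits.NavierStokesRegularity.NavierStokesRegularity.Theorems.AffineBernoulliAlignedStratumTrivialTools
import Summits.NavierStokesRegularity.NavierStokesRegularity.Theorems.AffineBernoulliAlignedStratumTrivialStep2
import Summits.NavierStokesRegularity.NavierStokesRegularity.Theses.AffineBernoulli
import HarnessLib

/-!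
# `AffineBernoulli.AlignedStratumTrivial` (item stmt-NavierStokesRegularity-13663, crux · rank 5), PROVED

**Statement (route AffineBernoulli).** For `c ∈ ℝ³`, `W ∈ C²(ℝ³; ℝ³)` divergence free, `P ∈ C¹`,
the self-similar Euler profile equation `½W + DW[½(y−c) + W] + ∇P = 0`, the decay
`‖W y‖ ≤ C(1+‖y‖)⁻¹`, `‖DW y‖ ≤ C((1+‖y‖)²)⁻¹`, and the ALIGNMENT `curl W y × (½(y−c) + W y) = 0`
for all `y` (the "similarity-Beltrami" stratum: no Bernoulli foliation), `W ≡ 0`.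

PROOF (flow-free; the profile equation and the gradient decay are not even used — the stratum is
empty for purely kinematic reasons). With `V y = ½(y − c) + W y`, `Ω = curl W`, `λ = ⟪Ω, V⟫/‖V‖²`:
1. ZERO SET (helper I `…Zeros`): at a zero of `V`, `Ω = 0` — differentiate `Ω × V ≡ 0`.
2. TRANSPORT (helper I): on `{V ≠ 0}`, `Ω = λV`, `Dλ[V] = −(3/2)λ` (`div Ω = 0`, `div V = 3/2`).
3. FAR FIELD (helper VI `…Step1`): `λ = 0` for `dist(y, c) > ρ₀ = √(2C(1+‖c‖)) + 1`, integrating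
   `0 < div (√(λ²+δ²) V) ≤ (3/2)δ` against a radially non-increasing test function (helper IV) times a
   smooth cutoff of the zero set (helper III; error `O(vol{0 < dist(·,K) < 4ε})` by 1.).
4. INTERIOR (helper VII `…Step2`): `λ = 0` on `{V ≠ 0}`, integrating
   `div ((λ²+δ²)^{1/4} V) ≥ (3/4)(λ²+δ²)^{1/4}` against a bump times the cutoff; the outer term is
   `O(√δ)` by 3.
5. Hence `curl W ≡ 0` (this file); with `div W = 0` and boundedness `W` is constant
   (`Literature…eq_of_curl_eq_zero_of_isDivFree_of_bounded`), and the decay forces the constant `0`.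

For the route: the aligned ("Beltrami-like") stratum of the Euler–Leray Liouville problem at
`γ = ½` is EMPTY with no non-degeneracy assumption on the zeros of the similarity field — the
refuters' "gap at equilibria with unstable rate ≥ 3/2" is closed by the zero-set lemma and two
divergence identities; no dynamics of `V` is used.

HONEST FRAMING: a Liouville theorem about HYPOTHETICAL self-similar Euler profiles
(Constantin–Ignatova–Vicol's `𝓔_½` window restricted to the aligned stratum); nothing here bears
on the regularity problem itself.
-/

noncomputable section

set_option linter.dupNamespace false

namespace Summit.NavierStokesRegularity.NavierStokesRegularity.Theorems

open Set Function Filter Topology InnerProductSpace Metric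
open scoped RealInnerProductSpace
open Literature.Analysis.FluidPDE

namespace AlignedStratum

/-- **The aligned vorticity vanishes identically.** `W ∈ C²`, `div W = 0`, `‖W y‖ ≤ C(1+‖y‖)⁻¹`,
`curl W y × (½(y−c) + W y) = 0` for all `y` ⟹ `curl W ≡ 0` (Step 2 off the zero set of the
similarity field, the zero-set lemma on it). -/
theorem curl_eq_zero {W : EuclideanSpace ℝ (Fin 3) → EuclideanSpace ℝ (Fin 3)}
    {c : EuclideanSpace ℝ (Fin 3)} {C : ℝ} (hW : ContDiff ℝ 2 W)
    (hdiv : VectorCalculus.IsDivFree W) (hWC : ∀ y, ‖W y‖ ≤ C * (1 + ‖y‖)⁻¹)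
    (halign : ∀ y, cross (curl W y) ((1 / 2 : ℝ) • (y - c) + W y) = 0)
    (y : EuclideanSpace ℝ (Fin 3)) : curl W y = 0 := by
  by_cases hV : (1 / 2 : ℝ) • (y - c) + W y = 0
  · exact curl_eq_zero_of_simField_eq_zero hW halign hV
  · rw [curl_eq_ratio_smul (halign y) hV, ratio_eq_zero hW hdiv hWC halign hV, zero_smul]

/-- **A bounded, decaying, divergence-free `C²` field with aligned vorticity is zero.** -/
theorem eq_zero_of_aligned {W : EuclideanSpace ℝ (Fin 3) → EuclideanSpace ℝ (Fin 3)}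
    {c : EuclideanSpace ℝ (Fin 3)} {C : ℝ} (hW : ContDiff ℝ 2 W)
    (hdiv : VectorCalculus.IsDivFree W) (hWC : ∀ y, ‖W y‖ ≤ C * (1 + ‖y‖)⁻¹)
    (halign : ∀ y, cross (curl W y) ((1 / 2 : ℝ) • (y - c) + W y) = 0)
    (y : EuclideanSpace ℝ (Fin 3)) : W y = 0 := by
  obtain ⟨hC0, hWb⟩ := decay_consts hWC
  -- `W` is constant
  have hconst : ∀ x, W x = W 0 := fun x =>
    eq_of_curl_eq_zero_of_isDivFree_of_bounded hW (curl_eq_zero hW hdiv hWC halign) hdiv hWb x 0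
  -- and the constant is `0` by the decay along `n • e₀`
  rw [hconst y]
  by_contra hne
  have hpos : 0 < ‖W 0‖ := norm_pos_iff.2 hne
  obtain ⟨n, hn⟩ := exists_nat_gt (C / ‖W 0‖)
  set e : EuclideanSpace ℝ (Fin 3) := EuclideanSpace.single 0 1 with he
  have he1 : ‖e‖ = 1 := by simp [he]
  have hen : ‖((n : ℝ) + 1) • e‖ = (n : ℝ) + 1 := by
    rw [norm_smul, he1, mul_one, Real.norm_eq_abs, abs_of_nonneg (by positivity)]
  have h1 := hWC (((n : ℝ) + 1) • e)
  rw [hconst, hen] at h1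
  -- `‖W 0‖ ≤ C / (n + 2)` contradicts `n > C / ‖W 0‖`
  have h2 : ‖W 0‖ * (1 + ((n : ℝ) + 1)) ≤ C := by
    have hpos' : (0 : ℝ) < 1 + ((n : ℝ) + 1) := by positivity
    have := mul_le_mul_of_nonneg_right h1 hpos'.le
    rwa [mul_assoc, inv_mul_cancel₀ hpos'.ne', mul_one] at this
  have h3 : C < ‖W 0‖ * (n : ℝ) := by
    have := (div_lt_iff₀ hpos).1 hn
    linarith
  nlinarith

end AlignedStratum

open AlignedStratum in
/-- **Item stmt-NavierStokesRegularity-13663** (`AffineBernoulli.AlignedStratumTrivial`, crux): the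
aligned (Beltrami-like) stratum of the self-similar Euler profile class `𝓔_½` is trivial — if
`curl W ∥ ½(y−c) + W` everywhere then `W ≡ 0`. The profile equation and the gradient decay clause
are not needed. -/
theorem affineBernoulli_alignedStratumTrivial_proof :
    Summit.NavierStokesRegularity.NavierStokesRegularity.Theses.AffineBernoulli.AlignedStratumTrivial := by
  intro c W P hW _hP hdiv _hprofile hdecay halign y
  obtain ⟨C, hC⟩ := hdecay
  exact eq_zero_of_aligned hW hdiv (fun z => (hC z).1) halign y

end Summit.NavierStokesRegularity.NavierStokesRegularity.Theorems
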